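import Mathlib
import Literature.NumberTheory.LFunctions.Zhang2022.Section5Lemma54SizeOne
import Literature.NumberTheory.LFunctions.Zhang2022.SkeletonPartOneB
import HarnessLib

/-!
# Zhang (2022), §5 / §7 (7.14): rapid decay of `δ(1+it)` for `|t| ≥ t₀^{1.03}`, kernel-checked

Topic `Literature/NumberTheory/LFunctions/Zhang2022` (Landau–Siegel audit tree; verdict-neutral).
Y. Zhang, *Discrete mean estimates and the Landau–Siegel zero*, arXiv:2211.02515v1 (2022)
[Zhang2022LandauSiegel] — **an unrefereed manuscript under adjudication** (cell `siegel-zhang`, D-0069).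
DAG nodes `Z22:(7.14)` / `Z22:Prop7.1.pf.b-error` [Z22 p.34, (7.14), tex L2012–2024], inherited by
`Z22:(14.5)`/`(14.6)` [Z22 p.82, tex L3907–3966]; GAP-LEDGER row **G-adj2-2**. The manuscript's
Lemma 5.4 (i) [p.28, tex L1523–1545] gives only `δ(s) ≪ 𝓛ᶜ|s|⁻²` and Lemma 5.6 covers `|t| ≤ D` only,
so the `|t| > D` part of the (7.14) integral needs a bound for `δ(1+it)` decaying faster than any power
of `t₀^{1.03}/|t|` — NOT in print. This file PROVES it, unconditionally, in the row's typed form: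

* `Skeleton.deltaW_rapid_decay` — **`∀ j, ∃ c C, ForAllLarge (∀ t, t₀^{1.03} ≤ |t| →
  ‖δ(1+it)‖ ≤ C·𝓛ᶜ·(t₀^{1.03}/|t|)ʲ)`**, `δ = Skeleton.deltaW D` ((5.14) at `𝓛₂ = 𝓛⁴⁰⁰`, `t₀ = 𝓛⁵¹⁹`).

Route, entirely from the tree's `Section5Lemma54PartOne`/`…DeltaDeriv`/`…SizeOne` (which treat
`Δ^{(n)} = Lemma53.phaseInt n` for every `n`): `integral_phaseInt_mul_cpow_eq_iterate` (`j`-fold partial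
integration `∫₀^∞ Δ^{(n)}x^{s−1} = (−1)ʲ(∏_{m<j}(s+m))⁻¹∫₀^∞ Δ^{(n+j)}x^{s+j−1}`, `σ > 0`);
`abs_pow_le_norm_prod_range` (`|t|ʲ ≤ ‖∏(1+it+m)‖`); `integral_norm_phaseInt_mul_rpow_le`
(`∫₀^∞‖Δ^{(j)}‖xʲ ≤ Jⱼ(1)Tʲ⁺¹ + M` for `L₂ ≥ 1 ≤ T` once `‖Δ^{(j)}‖xʲ ≤ Mx⁻²` beyond `T`: trivial bound
`norm_phaseInt_le` on `x ≤ T`; on `x > T` (`norm_phaseInt_mul_rpow_le_far`, `2t₀ < T^{0.99}`) the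
(5.12)-contour bound `norm_phaseInt_le_caseTwo` with
`c = 1/100`, `X = x^{0.99} > 2t₀`, the Gaussian-in-log terms via `e^{−(L₂log x/100)²}xʲ ≤ e^{2500(j+2)²}x⁻²`,
the `e^{−X/L₂}` term via `e^{−y} ≤ N!y^{−N}`, `N = 2j+4`, giving `M = (2+e)(4π)ʲe^{2500(j+2)²} +
e·Jⱼ(1)·(2j+4)!·L₂^{2j+4}`); `norm_delta514_one_add_mul_I_le` (`‖δ(1+it)‖ ≤ (Jⱼ(1)Tʲ⁺¹ + M)/|t|ʲ`); and the bookkeeping `T = t₀^{1.02}`, `T^{0.99} > 2t₀` once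
`𝓛 ≥ 2`, `Tʲ⁺¹ ≤ t₀^{1.03j}` once `j ≥ 102` (smaller `j` via `j+102`), `L₂^{2j+4} = 𝓛^{400(2j+4)}`.

NOT here: any use of the bound inside (7.14)/(14.5); any claim about Prop. 7.1, Prop. 14.1,
Theorems 1–2 or Landau–Siegel zeros. Constants are crude by design; only independence of `D` matters.

## References

* Y. Zhang, arXiv:2211.02515v1 (2022), §5 Lemma 5.4 (i) p.28 (proof); §7 (7.14) p.34; §14 (14.5)
  p.82. [cite: Zhang2022LandauSiegel, §5 Lemma 5.4 (i); §7 (7.14)]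
-/

noncomputable section

open Complex Real Set MeasureTheory Filter Topology

namespace Literature.NumberTheory.LFunctions.Zhang2022

namespace Lemma53

/-- **`j`-fold partial integration** for the Mellin transform of `Δ^{(n)}`: for `L₂ ≥ 1`, `σ > 0`,
`∫₀^∞ Δ^{(n)}(x)x^{s−1} dx = (−1)ʲ (∏_{m<j}(s+m))⁻¹ ∫₀^∞ Δ^{(n+j)}(x)x^{s+j−1} dx`
(the tree's one-step `integral_phaseInt_mul_cpow_eq`, iterated).
[cite: Zhang2022LandauSiegel, §5 Lemma 5.4 (i) (proof, "using partial integration twice")] -/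
theorem integral_phaseInt_mul_cpow_eq_iterate {L₂ : ℝ} (hL : 1 ≤ L₂) (t₀ : ℝ) (n : ℕ) {s : ℂ}
    (hs : 0 < s.re) (j : ℕ) :
    ∫ x in Ioi (0 : ℝ), phaseInt n L₂ t₀ x * (x : ℂ) ^ (s - 1)
      = (-1) ^ j * (∏ m ∈ Finset.range j, (s + m))⁻¹ *
          ∫ x in Ioi (0 : ℝ), phaseInt (n + j) L₂ t₀ x * (x : ℂ) ^ (s + j - 1) := by
  induction j with
  | zero => simp
  | succ j ih =>
    have hsj : 0 < (s + (j : ℂ)).re := by simp only [Complex.add_re, Complex.natCast_re]; positivity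
    have h1 := integral_phaseInt_mul_cpow_eq hL t₀ (n + j) (s := s + j) hsj
    have e2 : (∫ x in Ioi (0 : ℝ), phaseInt (n + (j + 1)) L₂ t₀ x * (x : ℂ) ^ (s + ↑(j + 1) - 1))
        = ∫ x in Ioi (0 : ℝ), phaseInt (n + j + 1) L₂ t₀ x * (x : ℂ) ^ (s + ↑j) := by
      congr 1; funext x; rw [← add_assoc]; congr 1; push_cast; ring_nf
    rw [ih, h1, e2, Finset.prod_range_succ, mul_inv, pow_succ]
    ring

/-- `|t|ʲ ≤ ‖∏_{m<j} (1 + it + m)‖` (each factor has imaginary part `t`). [folklore] -/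
private theorem abs_pow_le_norm_prod_range (t : ℝ) (j : ℕ) :
    |t| ^ j ≤ ‖∏ m ∈ Finset.range j, ((1 : ℂ) + t * I + m)‖ := by
  rw [norm_prod]
  calc |t| ^ j = ∏ _m ∈ Finset.range j, |t| := by simp
    _ ≤ ∏ m ∈ Finset.range j, ‖(1 : ℂ) + t * I + m‖ := by
        refine Finset.prod_le_prod (fun _ _ => abs_nonneg t) fun m _ => ?_
        have him : ((1 : ℂ) + t * I + m).im = t := by simp
        calc |t| = |((1 : ℂ) + t * I + m).im| := by rw [him]
          _ ≤ ‖(1 : ℂ) + t * I + m‖ := Complex.abs_im_le_norm _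

/-- `e^{−(L₂y/100)²} · e^{jy} ≤ e^{2500(j+2)²} · e^{−2y}` for `L₂ ≥ 1` (complete the square).
[folklore] -/
private theorem exp_neg_gauss_log_mul_le {L₂ : ℝ} (hL : 1 ≤ L₂) (y : ℝ) (j : ℕ) :
    Real.exp (-(1 / 100 * L₂ * y) ^ 2) * Real.exp (y * j)
      ≤ Real.exp (2500 * ((j : ℝ) + 2) ^ 2) * Real.exp (y * (-2)) := by
  rw [← Real.exp_add, ← Real.exp_add]
  apply Real.exp_le_exp.mpr
  have hL2 : 1 ≤ L₂ ^ 2 := one_le_pow₀ hL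
  have h1 : (1 / 100 * y) ^ 2 ≤ (1 / 100 * L₂ * y) ^ 2 := by
    have : (1 / 100 * L₂ * y) ^ 2 = L₂ ^ 2 * (1 / 100 * y) ^ 2 := by ring
    rw [this]; nlinarith [sq_nonneg (1 / 100 * y)]
  nlinarith [sq_nonneg (y - 5000 * ((j : ℝ) + 2))]

/-- `e^{−y} ≤ N!·y^{−N}` for `y > 0`, in the form `e^{−y} ≤ N!/y^N`. [folklore] -/
private theorem exp_neg_le_factorial_div_pow {y : ℝ} (hy : 0 < y) (N : ℕ) :
    Real.exp (-y) ≤ (N.factorial : ℝ) / y ^ N := by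
  have h := Real.pow_div_factorial_le_exp y hy.le N
  rw [div_le_iff₀ (by exact_mod_cast Nat.factorial_pos N)] at h
  rw [Real.exp_neg, inv_le_iff_one_le_mul₀ (Real.exp_pos y), div_mul_eq_mul_div,
    one_le_div (pow_pos hy N)]
  linarith

/-- On `0 < x ≤ T`: `‖Δ^{(j)}(x)‖xʲ ≤ Jⱼ(1)Tʲ` (trivial bound). [cite: Zhang2022LandauSiegel, §5 Lemma 5.4 (i) (proof)] -/
theorem norm_phaseInt_mul_rpow_le_near {L₂ : ℝ} (hL : 1 ≤ L₂) (t₀ : ℝ) {T x : ℝ} (hx0 : 0 < x)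
    (hxT : x ≤ T) (j : ℕ) :
    ‖phaseInt j L₂ t₀ x‖ * x ^ (j : ℝ) ≤ Jconst 1 j * T ^ j := by
  have h1 : ‖phaseInt j L₂ t₀ x‖ ≤ Jconst 1 j :=
    (norm_phaseInt_le (by linarith : L₂ ≠ 0) t₀ x j).trans (Jconst_le_Jconst_one hL j)
  have h2 : x ^ (j : ℝ) ≤ T ^ j := by
    rw [Real.rpow_natCast]; exact pow_le_pow_left₀ hx0.le hxT j
  exact mul_le_mul h1 h2 (by positivity) (Jconst_nonneg' 1 j)

/-- On `x > T ≥ 1` with `2t₀ < T^{0.99}`: `‖Δ^{(j)}(x)‖xʲ ≤ M·x⁻²`, `M = (2+e)(4π)ʲe^{2500(j+2)²} +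
e·Jⱼ(1)·(2j+4)!·L₂^{2j+4}` (the (5.12)-contour bound
with `c = 1/100`, `X = x^{0.99}`). [cite: Zhang2022LandauSiegel, §5 (5.9), (5.12), Lemma 5.4 (i) (proof)] -/
theorem norm_phaseInt_mul_rpow_le_far {L₂ : ℝ} (hL : 1 ≤ L₂) (t₀ : ℝ) {T x : ℝ} (hT : 1 ≤ T)
    (ht : 2 * t₀ < T ^ (0.99 : ℝ)) (hx : T < x) (j : ℕ) :
    ‖phaseInt j L₂ t₀ x‖ * x ^ (j : ℝ)
      ≤ ((2 + Real.exp 1) * (4 * π) ^ j * Real.exp (2500 * ((j : ℝ) + 2) ^ 2)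
          + Real.exp 1 * Jconst 1 j * (((2 * j + 4).factorial : ℝ) * L₂ ^ (2 * j + 4)))
        * x ^ (-2 : ℝ) := by
  have hL0 : 0 < L₂ := by linarith
  have hx1 : 1 ≤ x := hT.trans hx.le
  have hx0 : 0 < x := by linarith
  have hy : 0 ≤ Real.log x := Real.log_nonneg hx1
  set X : ℝ := x * Real.exp (-(1 / 100 * Real.log x)) with hXdef  -- `X = x^{0.99}`
  have hXeq : X = x ^ (0.99 : ℝ) := by
    rw [hXdef, Real.rpow_def_of_pos hx0,
      show Real.log x * 0.99 = Real.log x + -(1 / 100 * Real.log x) by ring, Real.exp_add,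
      Real.exp_log hx0]
  have h2t : 2 * t₀ < X :=
    lt_of_lt_of_le ht (hXeq ▸ Real.rpow_le_rpow (by linarith) hx.le (by norm_num))
  have hX0 : 0 < X := by positivity
  have hmain := norm_phaseInt_le_caseTwo hL t₀ hx0.le (c := 1 / 100) (X := X)
    (mul_nonneg (by norm_num) hy) hX0 le_rfl h2t j
  -- the Gaussian-in-log terms (powers of `x` as exponentials of `log x`)
  have hG : Real.exp (-(1 / 100 * L₂ * Real.log x) ^ 2) * x ^ (j : ℝ)
      ≤ Real.exp (2500 * ((j : ℝ) + 2) ^ 2) * x ^ (-2 : ℝ) := by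
    rw [Real.rpow_def_of_pos hx0, Real.rpow_def_of_pos hx0]
    exact exp_neg_gauss_log_mul_le hL (Real.log x) j
  have hT12 : (2 * (4 * π) ^ j * Real.exp (-(1 / 100 * L₂ * Real.log x) ^ 2)
        + (4 * π) ^ j * Real.exp (1 - (1 / 100 * L₂ * Real.log x) ^ 2) / L₂) * x ^ (j : ℝ)
      ≤ (2 + Real.exp 1) * (4 * π) ^ j * Real.exp (2500 * ((j : ℝ) + 2) ^ 2) * x ^ (-2 : ℝ) := by
    have e1 : Real.exp (1 - (1 / 100 * L₂ * Real.log x) ^ 2)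
        = Real.exp 1 * Real.exp (-(1 / 100 * L₂ * Real.log x) ^ 2) := by
      rw [← Real.exp_add, ← sub_eq_add_neg]
    have hdiv : (4 * π) ^ j * Real.exp (1 - (1 / 100 * L₂ * Real.log x) ^ 2) / L₂
        ≤ (4 * π) ^ j * Real.exp (1 - (1 / 100 * L₂ * Real.log x) ^ 2) :=
      div_le_self (by positivity) hL
    have hxj0 : 0 ≤ x ^ (j : ℝ) := Real.rpow_nonneg hx0.le _
    calc (2 * (4 * π) ^ j * Real.exp (-(1 / 100 * L₂ * Real.log x) ^ 2)
          + (4 * π) ^ j * Real.exp (1 - (1 / 100 * L₂ * Real.log x) ^ 2) / L₂) * x ^ (j : ℝ)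
        ≤ (2 * (4 * π) ^ j * Real.exp (-(1 / 100 * L₂ * Real.log x) ^ 2)
          + (4 * π) ^ j * Real.exp (1 - (1 / 100 * L₂ * Real.log x) ^ 2)) * x ^ (j : ℝ) := by
          gcongr
      _ = (2 + Real.exp 1) * (4 * π) ^ j
          * (Real.exp (-(1 / 100 * L₂ * Real.log x) ^ 2) * x ^ (j : ℝ)) := by rw [e1]; ring
      _ ≤ (2 + Real.exp 1) * (4 * π) ^ j
          * (Real.exp (2500 * ((j : ℝ) + 2) ^ 2) * x ^ (-2 : ℝ)) :=
          mul_le_mul_of_nonneg_left hG (by positivity)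
      _ = _ := by ring
  -- the `e^{−X/L₂}` term
  set N : ℕ := 2 * j + 4 with hN
  have hT3 : Real.exp (-(X / L₂)) * x ^ (j : ℝ) ≤ ((N.factorial : ℝ) * L₂ ^ N) * x ^ (-2 : ℝ) := by
    have h1 := exp_neg_le_factorial_div_pow (y := X / L₂) (by positivity) N
    have hXN : X ^ N = x ^ ((0.99 : ℝ) * N) := by
      rw [hXeq, ← Real.rpow_natCast, ← Real.rpow_mul hx0.le]
    have e : (N.factorial : ℝ) / (X / L₂) ^ N
        = (N.factorial : ℝ) * L₂ ^ N * x ^ (-((0.99 : ℝ) * N)) := by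
      rw [div_pow, hXN, Real.rpow_neg hx0.le]; field_simp
    rw [e] at h1
    have hexp : x ^ (-((0.99 : ℝ) * N)) * x ^ (j : ℝ) ≤ x ^ (-2 : ℝ) := by
      rw [← Real.rpow_add hx0]
      apply Real.rpow_le_rpow_of_exponent_le hx1
      rw [hN]; push_cast; nlinarith
    have hxj0 : 0 ≤ x ^ (j : ℝ) := Real.rpow_nonneg hx0.le _
    calc Real.exp (-(X / L₂)) * x ^ (j : ℝ)
        ≤ ((N.factorial : ℝ) * L₂ ^ N * x ^ (-((0.99 : ℝ) * N))) * x ^ (j : ℝ) :=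
          mul_le_mul_of_nonneg_right h1 hxj0
      _ = ((N.factorial : ℝ) * L₂ ^ N) * (x ^ (-((0.99 : ℝ) * N)) * x ^ (j : ℝ)) := by ring
      _ ≤ ((N.factorial : ℝ) * L₂ ^ N) * x ^ (-2 : ℝ) :=
          mul_le_mul_of_nonneg_left hexp (by positivity)
  have hJ : Real.exp 1 * Jconst L₂ j ≤ Real.exp 1 * Jconst 1 j :=
    mul_le_mul_of_nonneg_left (Jconst_le_Jconst_one hL j) (by positivity)
  have hJ0 : 0 ≤ Real.exp 1 * Jconst L₂ j := mul_nonneg (by positivity) (Jconst_nonneg' L₂ j)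
  have hxj0 : 0 ≤ x ^ (j : ℝ) := Real.rpow_nonneg hx0.le _
  calc ‖phaseInt j L₂ t₀ x‖ * x ^ (j : ℝ)
      ≤ (2 * (4 * π) ^ j * Real.exp (-(1 / 100 * L₂ * Real.log x) ^ 2)
          + (4 * π) ^ j * Real.exp (1 - (1 / 100 * L₂ * Real.log x) ^ 2) / L₂
          + Real.exp 1 * Jconst L₂ j * Real.exp (-(X / L₂))) * x ^ (j : ℝ) :=
        mul_le_mul_of_nonneg_right hmain hxj0
    _ = (2 * (4 * π) ^ j * Real.exp (-(1 / 100 * L₂ * Real.log x) ^ 2)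
          + (4 * π) ^ j * Real.exp (1 - (1 / 100 * L₂ * Real.log x) ^ 2) / L₂) * x ^ (j : ℝ)
        + Real.exp 1 * Jconst L₂ j * (Real.exp (-(X / L₂)) * x ^ (j : ℝ)) := by ring
    _ ≤ (2 + Real.exp 1) * (4 * π) ^ j * Real.exp (2500 * ((j : ℝ) + 2) ^ 2) * x ^ (-2 : ℝ)
        + Real.exp 1 * Jconst 1 j * (((N.factorial : ℝ) * L₂ ^ N) * x ^ (-2 : ℝ)) := by
        refine add_le_add hT12 ?_
        exact mul_le_mul hJ hT3 (by positivity) (le_trans hJ0 hJ)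
    _ = _ := by ring

/-- **`∫₀^∞ ‖Δ^{(j)}(x)‖xʲ dx ≤ Jⱼ(1)Tʲ⁺¹ + M`** for `L₂ ≥ 1`, `T ≥ 1`, whenever
`‖Δ^{(j)}(x)‖xʲ ≤ Mx⁻²` for `x > T` (the range `x ≤ T` by the trivial bound).
[cite: Zhang2022LandauSiegel, §5 Lemma 5.4 (i) (proof)] -/
theorem integral_norm_phaseInt_mul_rpow_le {L₂ : ℝ} (hL : 1 ≤ L₂) (t₀ : ℝ) {T M : ℝ} (hT : 1 ≤ T)
    (hM : 0 ≤ M) (j : ℕ)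
    (hfar : ∀ x : ℝ, T < x → ‖phaseInt j L₂ t₀ x‖ * x ^ (j : ℝ) ≤ M * x ^ (-2 : ℝ)) :
    ∫ x in Ioi (0 : ℝ), ‖phaseInt j L₂ t₀ x‖ * x ^ (j : ℝ) ≤ Jconst 1 j * T ^ (j + 1) + M := by
  have hT0 : 0 < T := by linarith
  have hI := integrableOn_norm_phaseInt_mul_rpow hL t₀ j (a := (j : ℝ) + 1) (by positivity)
  simp only [add_sub_cancel_right] at hI
  rw [← Ioc_union_Ioi_eq_Ioi hT0.le,
    setIntegral_union (Ioc_disjoint_Ioi le_rfl) measurableSet_Ioi (hI.mono_set Ioc_subset_Ioi_self)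
      (hI.mono_set (Ioi_subset_Ioi hT0.le))]
  refine add_le_add ?_ ?_
  · -- `(0, T]`
    have hconst : IntegrableOn (fun _ : ℝ => Jconst 1 j * T ^ j) (Ioc 0 T) :=
      integrableOn_const (measure_Ioc_lt_top (a := (0 : ℝ)) (b := T)).ne
    calc ∫ x in Ioc 0 T, ‖phaseInt j L₂ t₀ x‖ * x ^ (j : ℝ)
        ≤ ∫ _ in Ioc 0 T, Jconst 1 j * T ^ j :=
          setIntegral_mono_on (hI.mono_set Ioc_subset_Ioi_self) hconst measurableSet_Ioc
            fun x hx => norm_phaseInt_mul_rpow_le_near hL t₀ hx.1 hx.2 j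
      _ = Jconst 1 j * T ^ (j + 1) := by
          rw [setIntegral_const, smul_eq_mul, Real.volume_real_Ioc_of_le hT0.le, sub_zero, pow_succ]
          ring
  · -- `(T, ∞)`
    have hconst : IntegrableOn (fun x : ℝ => M * x ^ (-2 : ℝ)) (Ioi T) :=
      (integrableOn_Ioi_rpow_of_lt (by norm_num : (-2 : ℝ) < -1) hT0).const_mul _
    calc ∫ x in Ioi T, ‖phaseInt j L₂ t₀ x‖ * x ^ (j : ℝ)
        ≤ ∫ x in Ioi T, M * x ^ (-2 : ℝ) :=
          setIntegral_mono_on (hI.mono_set (Ioi_subset_Ioi hT0.le)) hconst measurableSet_Ioi hfar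
      _ = M * (T ^ (-1 : ℝ)) := by
          rw [MeasureTheory.integral_const_mul, integral_Ioi_rpow_of_lt (by norm_num) hT0]
          norm_num
      _ ≤ M * 1 := by
          refine mul_le_mul_of_nonneg_left ?_ hM
          rw [Real.rpow_neg_one]
          exact inv_le_one_of_one_le₀ hT
      _ = M := mul_one _

/-- **`‖δ(1+it)‖ ≤ (Jⱼ(1)Tʲ⁺¹ + M)/|t|ʲ`** for `L₂ ≥ 1`, `T ≥ 1`, `t ≠ 0`, any `j`, whenever
`‖Δ^{(j)}(x)‖xʲ ≤ Mx⁻²` for `x > T` (by `j`-fold partial integration and the integral bound).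
[cite: Zhang2022LandauSiegel, §5 Lemma 5.4 (i), (5.14)] -/
theorem norm_delta514_one_add_mul_I_le {L₂ : ℝ} (hL : 1 ≤ L₂) (t₀ : ℝ) {T M : ℝ} (hT : 1 ≤ T)
    (hM : 0 ≤ M) {t : ℝ} (ht0 : t ≠ 0) (j : ℕ)
    (hfar : ∀ x : ℝ, T < x → ‖phaseInt j L₂ t₀ x‖ * x ^ (j : ℝ) ≤ M * x ^ (-2 : ℝ)) :
    ‖delta514 L₂ t₀ (1 + t * I)‖ ≤ (Jconst 1 j * T ^ (j + 1) + M) / |t| ^ j := by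
  set s : ℂ := 1 + t * I with hs
  have hsre : 0 < s.re := by simp [hs]
  have e0 : (fun x : ℝ => Delta510 L₂ t₀ x * (x : ℂ) ^ (s - 1))
      = fun x : ℝ => phaseInt 0 L₂ t₀ x * (x : ℂ) ^ (s - 1) := by
    funext x; rw [phaseInt_zero]
  have hrep := integral_phaseInt_mul_cpow_eq_iterate hL t₀ 0 hsre j
  simp only [Nat.zero_add] at hrep
  have htj : 0 < |t| ^ j := pow_pos (abs_pos.mpr ht0) j
  have hprod : |t| ^ j ≤ ‖∏ m ∈ Finset.range j, (s + m)‖ := by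
    simpa [hs] using abs_pow_le_norm_prod_range t j
  have hprod0 : 0 < ‖∏ m ∈ Finset.range j, (s + m)‖ := lt_of_lt_of_le htj hprod
  have hbound : ‖∫ x in Ioi (0 : ℝ), phaseInt j L₂ t₀ x * (x : ℂ) ^ (s + j - 1)‖
      ≤ Jconst 1 j * T ^ (j + 1) + M := by
    calc ‖∫ x in Ioi (0 : ℝ), phaseInt j L₂ t₀ x * (x : ℂ) ^ (s + j - 1)‖
        ≤ ∫ x in Ioi (0 : ℝ), ‖phaseInt j L₂ t₀ x * (x : ℂ) ^ (s + j - 1)‖ :=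
          norm_integral_le_integral_norm _
      _ = ∫ x in Ioi (0 : ℝ), ‖phaseInt j L₂ t₀ x‖ * x ^ (j : ℝ) := by
          refine setIntegral_congr_fun measurableSet_Ioi fun x hx => ?_
          rw [norm_mul, Complex.norm_cpow_eq_rpow_re_of_pos hx]
          simp [hs]
      _ ≤ Jconst 1 j * T ^ (j + 1) + M := integral_norm_phaseInt_mul_rpow_le hL t₀ hT hM j hfar
  rw [delta514, e0, hrep, norm_mul, norm_mul, norm_pow, norm_neg, norm_one, one_pow, one_mul,
    norm_inv]
  calc ‖∏ m ∈ Finset.range j, (s + m)‖⁻¹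
        * ‖∫ x in Ioi (0 : ℝ), phaseInt j L₂ t₀ x * (x : ℂ) ^ (s + j - 1)‖
      ≤ (|t| ^ j)⁻¹ * (Jconst 1 j * T ^ (j + 1) + M) :=
        mul_le_mul ((inv_le_inv₀ hprod0 htj).mpr hprod) hbound (norm_nonneg _) (by positivity)
    _ = (Jconst 1 j * T ^ (j + 1) + M) / |t| ^ j := by rw [div_eq_inv_mul]

end Lemma53

namespace Skeleton

/-- `𝓛 = log D ≥ 2` once `D ≥ 8` (`e² < 8`). [folklore] -/
private theorem two_le_ell {D : ℕ} (hD : 8 ≤ D) : 2 ≤ ell D := by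
  rw [ell, Real.le_log_iff_exp_le (by exact_mod_cast (show 0 < D by omega))]
  have h1 := Real.exp_one_lt_d9
  have h8 : (8 : ℝ) ≤ D := by exact_mod_cast hD
  have : Real.exp 2 = Real.exp 1 * Real.exp 1 := by rw [← Real.exp_add]; norm_num
  rw [this]
  nlinarith [Real.exp_pos 1]

/-- The core estimate for `j ≥ 102`: `‖δ(1+it)‖ ≤ C·𝓛^{400(2j+4)}·(t₀^{1.03}/|t|)ʲ` for `D ≥ 8`,
`t₀^{1.03} ≤ |t|`, with `C = Jⱼ(1) + (2+e)(4π)ʲe^{2500(j+2)²} + e·Jⱼ(1)·(2j+4)!`.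
[cite: Zhang2022LandauSiegel, §5 Lemma 5.4 (i); §7 (7.14)] -/
theorem norm_deltaW_le_of_le {j : ℕ} (hj : 102 ≤ j) {D : ℕ} (hD : 8 ≤ D) {t : ℝ}
    (ht : t0 D ^ (1.03 : ℝ) ≤ |t|) :
    ‖deltaW D (1 + t * I)‖
      ≤ (Lemma53.Jconst 1 j + (2 + Real.exp 1) * (4 * π) ^ j * Real.exp (2500 * ((j : ℝ) + 2) ^ 2)
            + Real.exp 1 * Lemma53.Jconst 1 j * (2 * j + 4).factorial)
          * ell D ^ (((400 * (2 * j + 4) : ℕ) : ℝ)) * (t0 D ^ (1.03 : ℝ) / |t|) ^ j := by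
  have hℓ : 2 ≤ ell D := two_le_ell hD
  have hℓ1 : 1 ≤ ell D := by linarith
  have hL : 1 ≤ ell2 D := by rw [ell2]; exact one_le_pow₀ hℓ1
  have ht0def : t0 D = ell D ^ 519 := rfl
  have ht01 : 1 ≤ t0 D := by rw [ht0def]; exact one_le_pow₀ hℓ1
  have ht00 : 0 < t0 D := by linarith
  -- `2t₀ < (t₀^{1.02})^{0.99} = t₀ · t₀^{0.0098}`, from `t₀ ≥ 2^{519}`
  have h2t : 2 * t0 D < (t0 D ^ (1.02 : ℝ)) ^ (0.99 : ℝ) := by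
    rw [← Real.rpow_mul ht00.le, show (1.02 : ℝ) * 0.99 = 1 + 0.0098 by norm_num,
      Real.rpow_add ht00, Real.rpow_one, mul_comm]
    refine mul_lt_mul_of_pos_left ?_ ht00
    have h2 : (2 : ℝ) ^ (519 : ℕ) ≤ t0 D := by rw [ht0def]; exact pow_le_pow_left₀ (by norm_num) hℓ _
    refine lt_of_lt_of_le ?_ (Real.rpow_le_rpow (pow_nonneg (by norm_num) _) h2 (by norm_num))
    rw [← Real.rpow_natCast, ← Real.rpow_mul (by norm_num)]
    calc (2 : ℝ) = 2 ^ (1 : ℝ) := (Real.rpow_one 2).symm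
      _ < 2 ^ (((519 : ℕ) : ℝ) * 0.0098) := Real.rpow_lt_rpow_of_exponent_lt (by norm_num) (by norm_num)
  have hT1 : 1 ≤ t0 D ^ (1.02 : ℝ) := Real.one_le_rpow ht01 (by norm_num)
  have htpos : 0 < |t| := lt_of_lt_of_le (Real.rpow_pos_of_pos ht00 _) ht
  -- the constants: `A` (Gaussian-in-log), `B = e·Jⱼ(1)·(2j+4)!`, `K = 𝓛^{400(2j+4)}`, `Y = t₀^{1.03j}`
  set A : ℝ := (2 + Real.exp 1) * (4 * π) ^ j * Real.exp (2500 * ((j : ℝ) + 2) ^ 2) with hA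
  set B : ℝ := Real.exp 1 * Lemma53.Jconst 1 j * (2 * j + 4).factorial with hB
  set K : ℝ := ell D ^ (((400 * (2 * j + 4) : ℕ) : ℝ)) with hK
  have hJ0 : 0 ≤ Lemma53.Jconst 1 j := Lemma53.Jconst_nonneg' 1 j
  have hA0 : 0 ≤ A := by positivity
  have hB0 : 0 ≤ B := by positivity
  have hK1 : 1 ≤ K := Real.one_le_rpow hℓ1 (by positivity)
  have hL2c : ell2 D ^ (2 * j + 4) = K := by rw [hK, Real.rpow_natCast, ell2, ← pow_mul]
  have hM0 : 0 ≤ A + Real.exp 1 * Lemma53.Jconst 1 j * ((2 * j + 4).factorial * ell2 D ^ (2 * j + 4)) := by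
    positivity
  have hmain := Lemma53.norm_delta514_one_add_mul_I_le hL (t0 D) hT1 hM0 (abs_pos.mp htpos) j
    fun x hx => Lemma53.norm_phaseInt_mul_rpow_le_far hL (t0 D) hT1 h2t hx j
  have hpowj : (t0 D ^ (1.03 : ℝ)) ^ j = t0 D ^ ((1.03 : ℝ) * j) := by
    rw [← Real.rpow_natCast, ← Real.rpow_mul ht00.le]
  have hY1 : 1 ≤ t0 D ^ ((1.03 : ℝ) * j) := Real.one_le_rpow ht01 (by positivity)
  have hT' : (t0 D ^ (1.02 : ℝ)) ^ (j + 1) ≤ t0 D ^ ((1.03 : ℝ) * j) := by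
    rw [← Real.rpow_natCast, ← Real.rpow_mul ht00.le]
    refine Real.rpow_le_rpow_of_exponent_le ht01 ?_
    have : (102 : ℝ) ≤ j := by exact_mod_cast hj
    push_cast
    linarith only [this]
  have i1 : Lemma53.Jconst 1 j * (t0 D ^ (1.02 : ℝ)) ^ (j + 1)
      ≤ Lemma53.Jconst 1 j * (K * t0 D ^ ((1.03 : ℝ) * j)) :=
    mul_le_mul_of_nonneg_left (hT'.trans (le_mul_of_one_le_left (zero_le_one.trans hY1) hK1)) hJ0
  have i2 : A + Real.exp 1 * Lemma53.Jconst 1 j * ((2 * j + 4).factorial * ell2 D ^ (2 * j + 4))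
      ≤ (A + B) * K * t0 D ^ ((1.03 : ℝ) * j) := by
    rw [hL2c]
    have : A + Real.exp 1 * Lemma53.Jconst 1 j * ((2 * j + 4).factorial * K) ≤ (A + B) * K := by
      rw [hB]; nlinarith only [hA0, hK1]
    exact this.trans (le_mul_of_one_le_right (by positivity) hY1)
  calc ‖deltaW D (1 + t * I)‖
      ≤ (Lemma53.Jconst 1 j * (t0 D ^ (1.02 : ℝ)) ^ (j + 1)
          + (A + Real.exp 1 * Lemma53.Jconst 1 j * ((2 * j + 4).factorial * ell2 D ^ (2 * j + 4))))
          / |t| ^ j := hmain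
    _ ≤ (Lemma53.Jconst 1 j + A + B) * K * t0 D ^ ((1.03 : ℝ) * j) / |t| ^ j :=
        div_le_div_of_nonneg_right (by linarith only [i1, i2]) (pow_nonneg htpos.le j)
    _ = (Lemma53.Jconst 1 j + A + B) * K * (t0 D ^ (1.03 : ℝ) / |t|) ^ j := by
        rw [div_pow, hpowj]; ring

/-- **GAP-LEDGER row G-adj2-2, PROVED: rapid decay of `δ(1+it)` for `|t| ≥ t₀^{1.03}`.** For every
`j : ℕ` there are reals `c, C` such that for all sufficiently large `D` (and, vacuously, every real
primitive `χ mod D`): `∀ t, t₀^{1.03} ≤ |t| → ‖δ(1+it)‖ ≤ C·𝓛ᶜ·(t₀^{1.03}/|t|)ʲ`, where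
`δ = Skeleton.deltaW D` is (5.14) at the manuscript's `𝓛₂ = 𝓛⁴⁰⁰`, `t₀ = 𝓛⁵¹⁹`. This is the
strengthening of Lemma 5.4 (i) that the `|t| > D` part of the (7.14) integral (and its (14.5)
analogue) requires; it is not stated in the manuscript. Unconditional; no (A); no named fact.
[cite: Zhang2022LandauSiegel, §5 Lemma 5.4 (i); §7 (7.14); §14 (14.5)] -/
theorem deltaW_rapid_decay (j : ℕ) :
    ∃ c C : ℝ, ForAllLarge fun D _ _ => ∀ t : ℝ, t0 D ^ (1.03 : ℝ) ≤ |t| →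
      ‖deltaW D (1 + t * I)‖ ≤ C * ell D ^ c * (t0 D ^ (1.03 : ℝ) / |t|) ^ j := by
  set j' : ℕ := j + 102 with hj'
  refine ⟨((400 * (2 * j' + 4) : ℕ) : ℝ), Lemma53.Jconst 1 j'
    + (2 + Real.exp 1) * (4 * π) ^ j' * Real.exp (2500 * ((j' : ℝ) + 2) ^ 2)
    + Real.exp 1 * Lemma53.Jconst 1 j' * (2 * j' + 4).factorial, 8, fun D _ χ hD _ _ t ht => ?_⟩
  have hℓ1 : 1 ≤ ell D := by linarith [two_le_ell hD]
  have ht00 : 0 < t0 D := lt_of_lt_of_le zero_lt_one (one_le_pow₀ hℓ1)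
  have htpos : 0 < |t| := lt_of_lt_of_le (Real.rpow_pos_of_pos ht00 _) ht
  have hJ0 : 0 ≤ Lemma53.Jconst 1 j' := Lemma53.Jconst_nonneg' 1 j'
  have hℓ0 : 0 ≤ ell D := zero_le_one.trans hℓ1
  exact (norm_deltaW_le_of_le (j := j') (by omega) hD ht).trans (mul_le_mul_of_nonneg_left
    (pow_le_pow_of_le_one (by positivity) ((div_le_one htpos).mpr ht) (by omega)) (by positivity))

end Skeleton

end Literature.NumberTheory.LFunctions.Zhang2022
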